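import Summits.FinalStateConjecture.FinalStateConjecture.Theorems.PhaseMixingCaptureCaptureSufficesC2StubSoftShieldedScriLeafTransfer
import Summits.FinalStateConjecture.FinalStateConjecture.Theorems.PhaseMixingCaptureCaptureSufficesC2StubSoftShieldedScriLocalisation
import Summits.FinalStateConjecture.FinalStateConjecture.Theorems.KerrShieldedDataExist.Negative.BentHeight
import Summits.FinalStateConjecture.FinalStateConjecture.Statement
import Literature.Geometry.Lorentzian.DataEmbeddingConstraints
import Literature.Geometry.Lorentzian.StabilityCauchy
import Literature.Geometry.Lorentzian.FinalState
import HarnessLib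

/-!
# Crux `PhaseMixingCapture.CaptureSufficesC2` (stmt-FinalStateConjecture-14986), line `Sketch`,
# stub `stub_softShieldedScri` — support file 3: the ASSEMBLY modulo the LEAF PACKAGE

**`stub_softShieldedScri` from the leaf package** (`softShieldedScri_of_leafPackage`).  The
registered stub S3 says: given hypersurface sub-data maximality (Stub 2) and one `CaptureAtC2`
package at `(s, δ, M, ε, 1, a)`, every MGHD `𝓜` of every admissible datum `D` on `X` that is
ε-softly Kerr-shielded (C2 form) by `(M, a)` has complete future null infinity in Christodoulou's
sojourn form.  This file proves S3 from ONE displayed hypothesis, the LEAF PACKAGE, which isolates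
the Kerr-explicit optics of the exact sandwich between the bent data slice `{t* = T_{M,a}(r)}` and
the flat Kerr–Schild leaf `{t* = 0}`:

LEAF PACKAGE.  Given Stub 2 (displayed), for `M > 0`, `|a| < M`, a datum `D` on `X` and a shield
`(φ, ψ, ν)` — `φ : Kerr.slice a M → X` a `C^{∞+1}` open embedding with injective differentials,
co-compact range and co-compact far ends, `ψ` the graph of the bent height `T_{M,a}` over the slice,
spacelike with future unit normal `ν`, and the EXACT clauses `φ^* h = ψ^* g_{M,a}`,
`φ^* k = K_ν(ψ)` on `{r ≥ 3M}` (clauses (ii) of `IsSoftKerrShieldedC2`; the closeness clauses (i),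
(iii) are NOT assumed) —, in every MGHD `𝓜` of `D` there are a leaf datum `D_S` on `Kerr.slice a M`,
a leaf `j : Kerr.slice a M → 𝓜` and a normal field `ν_j` along it such that
(P1) `D_S = Kerr.data M a M` beyond `r > 4M` and `D_S = φ^* D` on the collar `{M < r < 4M}`
(equalities of the component functions `hFun`, `kFun`);
(P2) `j` is a smooth embedding with future unit normal `ν_j` inducing `D_S` (`j^* g = h_S`,
`K_{ν_j}(j) = k_S`), with ACAUSAL range;
(P3) the leaf lies in `J⁻(ι X)`;
(P4) FOOT POINTS: there is `c > 0` such that for every compact `C` of the slice there is a compact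
`K ⊆ X` such that every normalised null ray `γ : dom` of `𝓜` from `ι x`, `x ∉ K`, passes at a
parameter `−t₀ ≤ 0` through a leaf point `j p`, `p` in the closed far region `Kerr.farSlice a M`,
`p ∉ C`, with `−c ≤ g(γ'(−t₀), ν_j p)`, the pre-segment `γ[−t₀, 0)` avoiding `J⁺(j C)`.
(Intended witnesses: `j = ι ∘ φ` on `{r < 4M}` and `j = E(0, ·)` on `{r > 3M}`, `E` the
realisation in `𝓜` — Stub 2 applied to `ι ∘ φ|{r > 3M}`, then maximality against the exact Kerr
sandwich development, `Kerr.isRicciFlat_holds` — of a globally hyperbolic Kerr neighbourhood of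
`ψ{r > 3M} ∪ {t* = 0, r > 4M}`; (P4) is the optics of the sandwich: affine factor `1 + O(M/r)`,
pre-segment radius `≥ r − O(log r)`, `t*` a time function, light cones inside the Minkowski cones
of the Kerr–Schild chart.)

ASSEMBLY (this file).  Unpack the shield; take `(D_S, j, ν_j)` from the package; `(𝓜, j, ν_j)` is a
data embedding of `D_S`, so Stub 2 realises the MGHD `𝒟_S` of `D_S` in `𝓜` by `χ`, `χ ∘ ι_S = j`,
and `dχ ν_S = ν_j` (uniqueness of the future unit normal, `SubdataDevelopmentsEmbed.mfderiv_normal_rel`);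
`D_S` is vacuum (data of a vacuum Cauchy development, `VacuumCauchyDevelopment.isVacuumConstraintSolution_data`),
and b-conormal and ε-close to `Kerr.data M a M` because its slice distance LOCALISES to the collar
seminorms of clauses (i)/(iii) of the shield (`dataWeightedSobolevEDist_slice_le_collar`, p99405, with
(P1)); the capture block gives `𝒟_S.HasCompleteFutureNullInfinityFar`; the registered leaf transfer
`stub_softShieldedScri_leafTransfer` (p107537) with origins `A := range (Kerr.farSliceIncl a M)`
concludes.

References: D. Christodoulou, CQG 16 (1999) A23, pp. A26–A27; M. Dafermos, I. Rodnianski,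
arXiv:0811.0354, §2.6.2, §5.1; Y. Choquet-Bruhat, R. Geroch, CMP 14 (1969), Thm. 3; B. O'Neill
(1983), Ch. 14; R. Bartnik, CPAM 39 (1986), (1.2).
-/

set_option linter.dupNamespace false

noncomputable section

open scoped Manifold ContDiff Topology
open Set Function Filter Topology Literature.Geometry.Lorentzian
open Summit.FinalStateConjecture.FinalStateConjecture.Theorems.KerrShieldedDataExist.Negative (bentHeight)

namespace Summit.FinalStateConjecture.FinalStateConjecture.Theorems.CaptureSufficesC2.Sketch

namespace SoftShieldedScri

/-- **Registered sub-goal `stub_softShieldedScri_leafDatumClose` of stub `stub_softShieldedScri`**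
(line `Sketch`, crux stmt-FinalStateConjecture-14986): **the leaf datum is b-conormal and ε-close to
`Kerr.data M a M`.**  If a datum `D_S` on `Kerr.slice a M` agrees (componentwise, `hFun`/`kFun`)
with the Kerr–Schild leaf datum beyond `r > 4M` and with the pulled-back shield datum `φ^* D` on the
collar `{M < r < 4M}` (clause (P1) of the leaf package), then clauses (i) (collar closeness at level
`(s, δ)`) and (iii) (all collar seminorms finite) of `IsSoftKerrShieldedC2` give
`dist_{s', δ}(D_S, Kerr.data) < ⊤` for every `s'` and `dist_{s, δ}(D_S, Kerr.data) < ε` IN THE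
SLICE — the form consumed by `CaptureAtC2`: the slice distance localises to the collar
(`dataWeightedSobolevEDist_slice_le_collar`, the sphere `{r = 4M}` being null).  Bartnik, CPAM 39
(1986), (1.2); Dafermos–Rodnianski arXiv:0811.0354, §5.1. [cite: Bartnik1986, (1.2)] -/
theorem stub_softShieldedScri_leafDatumClose : ∀ [Kerr.Facts] [Kerr.SliceFacts] (s : ℕ) (δ M ε a : ℝ), 0 < M → ∀ (hM : 0 ≤ M) (X : Type) [TopologicalSpace X] [ChartedSpace E3 X] [IsManifold (𝓡 3) ∞ X] (D : InitialDataSet (𝓡 3) X) (φ : Kerr.slice a M → X) (hφ : ContMDiff 𝓘(ℝ, E3) (𝓡 3) (∞ + 1) φ) (hφ' : ∀ u, Function.Injective (mfderiv 𝓘(ℝ, E3) (𝓡 3) φ u)) (D_S : InitialDataSet 𝓘(ℝ, E3) (Kerr.slice a M)), (∀ y : E3, 4 * M < Kerr.radius a (E4.ofTimeSpace 0 y) → D_S.hFun y = (Kerr.data M a M hM).hFun y) → (∀ y : E3, 4 * M < Kerr.radius a (E4.ofTimeSpace 0 y) → D_S.kFun y = (Kerr.data M a M hM).kFun y) → (∀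 y : E3, M < Kerr.radius a (E4.ofTimeSpace 0 y) → Kerr.radius a (E4.ofTimeSpace 0 y) < 4 * M → (D.comap φ hφ hφ').hFun y = D_S.hFun y) → (∀ y : E3, M < Kerr.radius a (E4.ofTimeSpace 0 y) → Kerr.radius a (E4.ofTimeSpace 0 y) < 4 * M → (D.comap φ hφ hφ').kFun y = D_S.kFun y) → weightedSobolevSeminorm {y : E3 | M < Kerr.radius a (E4.ofTimeSpace 0 y) ∧ Kerr.radius a (E4.ofTimeSpace 0 y) < 4 * M} s δ ((D.comap φ hφ hφ').hFun - (Kerr.data M a M hM).hFun) + weightedSobolevSeminorm {y : E3 | M < Kerr.radius a (E4.ofTimeSpace 0 y) ∧ Kerr.radius a (E4.ofTimeSpace 0 y) < 4 * M} (s - 1) (δ + 1) ((D.comap φ hφ hφ').kFun - (Kerr.data M a M hM).kFun) < ENNReal.ofReal ε → (∀ s' : ℕ, weightedSobolevSeminorm {y : E3 | M < Kerr.radius a (E4.ofTimeSpace 0 y) ∧ Kerr.radius a (E4.ofTimeSpace 0 y) < 4 * M} s' δ ((D.comap φ hφ hφ').hFun - (Kerr.data M a M hM).hFun) + weightedSobolevSeminorm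 {y : E3 | M < Kerr.radius a (E4.ofTimeSpace 0 y) ∧ Kerr.radius a (E4.ofTimeSpace 0 y) < 4 * M} (s' - 1) (δ + 1) ((D.comap φ hφ hφ').kFun - (Kerr.data M a M hM).kFun) < ⊤) → (∀ s' : ℕ, InitialDataSet.dataWeightedSobolevEDist s' δ D_S (Kerr.data M a M hM) < ⊤) ∧ InitialDataSet.dataWeightedSobolevEDist s δ D_S (Kerr.data M a M hM) < ENNReal.ofReal ε :=
  fun s δ M ε a hM₀ hM X _ _ _ D φ hφ hφ' D_S hfarh hfark hcolh hcolk hclose hconormal ↦ by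
    have hloc : ∀ (s' : ℕ) (δ' : ℝ),
        InitialDataSet.dataWeightedSobolevEDist s' δ' D_S (Kerr.data M a M hM) ≤
          weightedSobolevSeminorm
              {y : E3 | M < Kerr.radius a (E4.ofTimeSpace 0 y) ∧
                Kerr.radius a (E4.ofTimeSpace 0 y) < 4 * M} s' δ'
              ((D.comap φ hφ hφ').hFun - (Kerr.data M a M hM).hFun) +
            weightedSobolevSeminorm
              {y : E3 | M < Kerr.radius a (E4.ofTimeSpace 0 y) ∧
                Kerr.radius a (E4.ofTimeSpace 0 y) < 4 * M} (s' - 1) (δ' + 1)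
              ((D.comap φ hφ hφ').kFun - (Kerr.data M a M hM).kFun) := fun s' δ' ↦
      dataWeightedSobolevEDist_slice_le_collar hM₀ le_rfl D_S (Kerr.data M a M hM) hfarh hfark
        hcolh hcolk s' δ'
    exact ⟨fun s' ↦ (hloc s' δ).trans_lt (hconormal s'), (hloc s δ).trans_lt hclose⟩

/-- **`stub_softShieldedScri` FROM THE LEAF PACKAGE** (line `Sketch`, crux
stmt-FinalStateConjecture-14986).  The first hypothesis is the LEAF PACKAGE of the module docstring
(Stub 2 displayed → for every shield `(φ, ψ, ν)` with the exact clauses on `{r ≥ 3M}` and every MGHD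
`𝓜` of `D`, a leaf datum `D_S`, a leaf `j` and a normal `ν_j` with (P1)–(P4)); the conclusion is
the registered statement of `stub_softShieldedScri` VERBATIM (Stub 2 → `CaptureAtC2 s δ M ε 1 a` →
admissible ε-softly Kerr-shielded data have MGHDs with complete `𝓘⁺`).  Proof: module docstring,
ASSEMBLY. [cite: Christodoulou1999, pp. A26–A27] -/
theorem softShieldedScri_of_leafPackage : ((∀ (X : Type) [TopologicalSpace X] [ChartedSpace E3 X] [IsManifold (𝓡 3) ∞ X] [T2Space X] [SecondCountableTopology X] [ConnectedSpace X] (D : InitialDataSet (𝓡 3) X) (𝓜 : VacuumCauchyDevelopment D), 𝓜.IsMaximal → ∀ (N : Type) [TopologicalSpace N] [ChartedSpace E3 N] [IsManifold (𝓡 3) ∞ N] [ConnectedSpace N] (D' : InitialDataSet (𝓡 3) N) (j : N → 𝓜.carrier) (ν : NormalField (𝓡 4) j), Manifold.IsSmoothEmbedding (𝓡 3) (𝓡 4) ∞ j → 𝓜.metric.IsFutureUnitNormal (𝓡 3) 𝓜.timeOrientation j ν → (∀ y : N, pullbackBilin (I := 𝓡 4) (I' := 𝓡 3) j 𝓜.metric.val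 y = D'.h.inner y) → (∀ [𝓜.metric.toPseudoRiemannianMetric.HasLeviCivita] (y : N), 𝓜.metric.toPseudoRiemannianMetric.secondFundamentalForm (𝓡 3) j ν y = D'.kBilin y) → (∀ p ∈ Set.range j, ∀ q ∈ Set.range j, q ∈ 𝓜.metric.causalFuture 𝓜.timeOrientation {p} → q = p) → ∃ 𝒟' : VacuumCauchyDevelopment D', 𝒟'.IsMaximal ∧ ∃ χ : 𝒟'.carrier → 𝓜.carrier, ContMDiff (𝓡 4) (𝓡 4) ∞ χ ∧ Topology.IsOpenEmbedding χ ∧ 𝒟'.metric.IsIsometricImmersion 𝓜.metric.toPseudoRiemannianMetric χ ∧ 𝒟'.timeOrientation.PreservesTimeOrientation χ 𝓜.timeOrientation ∧ χ ∘ 𝒟'.embed = j) → ∀ [Kerr.Facts] [Kerr.SliceFacts] (M a : ℝ) (hM : 0 < M) (X : Type) [TopologicalSpace X] [ChartedSpace E3 X] [IsManifold (𝓡 3) ∞ X] [T2Space X] [SecondCountableTopology X] [ConnectedSpace X] (D : InitialDataSet (𝓡 3) X) (φ : Kerr.slice a M → X) (hφ : ContMDiff 𝓘(ℝ, E3) (𝓡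 3) (∞ + 1) φ) (hφ' : ∀ u, Function.Injective (mfderiv 𝓘(ℝ, E3) (𝓡 3) φ u)) (ψ : Kerr.slice a M → Kerr.region a M) (ν : NormalField 𝓘(ℝ, E4) ψ), |a| < M → IsCompact (Set.range φ)ᶜ → Topology.IsOpenEmbedding φ → (∀ R : ℝ, IsCompact (φ '' {y : Kerr.slice a M | R < Kerr.radius a (E4.ofTimeSpace 0 (y : E3))})ᶜ) → (∀ y : Kerr.slice a M, (ψ y : E4) = E4.ofTimeSpace (bentHeight M a (Kerr.radius a (E4.ofTimeSpace 0 (y : E3)))) (y : E3)) → (Kerr.smoothMetric M a M).IsSpacelikeImmersion 𝓘(ℝ, E3) ψ → (Kerr.smoothMetric M a M).IsFutureUnitNormal 𝓘(ℝ, E3) ((Kerr.timeOrientation M a M hM.le).ofLE le_top) ψ ν → (∀ y : Kerr.slice a M, 3 * M ≤ Kerr.radius a (E4.ofTimeSpace 0 (y : E3)) → pullbackBilin (I := 𝓡 3) (I' := 𝓘(ℝ, E3)) φ D.h.inner y = pullbackBilin (I := 𝓘(ℝ, E4)) (I' := 𝓘(ℝ, E3)) ψ (Kerr.smoothMetric M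 a M).val y) → (∀ [(Kerr.smoothMetric M a M).HasLeviCivita] (y : Kerr.slice a M), 3 * M ≤ Kerr.radius a (E4.ofTimeSpace 0 (y : E3)) → (pullbackBilin (I := 𝓡 3) (I' := 𝓘(ℝ, E3)) φ D.k y).toLinearMap₁₂ = (Kerr.smoothMetric M a M).secondFundamentalForm 𝓘(ℝ, E3) ψ ν y) → ∀ (𝓜 : VacuumCauchyDevelopment D), 𝓜.IsMaximal → ∃ (D_S : InitialDataSet 𝓘(ℝ, E3) (Kerr.slice a M)) (j : Kerr.slice a M → 𝓜.carrier) (νj : NormalField (𝓡 4) j), (∀ y : E3, 4 * M < Kerr.radius a (E4.ofTimeSpace 0 y) → D_S.hFun y = (Kerr.data M a M hM.le).hFun y) ∧ (∀ y : E3, 4 * M < Kerr.radius a (E4.ofTimeSpace 0 y) → D_S.kFun y = (Kerr.data M a M hM.le).kFun y) ∧ (∀ y : E3, M < Kerr.radius a (E4.ofTimeSpace 0 y) → Kerr.radius a (E4.ofTimeSpace 0 y) < 4 * M → (D.comap φ hφ hφ').hFun y = D_S.hFun y) ∧ (∀ y : E3, M < Kerr.radius a (E4.ofTimeSpace 0 y)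 → Kerr.radius a (E4.ofTimeSpace 0 y) < 4 * M → (D.comap φ hφ hφ').kFun y = D_S.kFun y) ∧ Manifold.IsSmoothEmbedding (𝓡 3) (𝓡 4) ∞ j ∧ 𝓜.metric.IsFutureUnitNormal (𝓡 3) 𝓜.timeOrientation j νj ∧ (∀ y : Kerr.slice a M, pullbackBilin (I := 𝓡 4) (I' := 𝓡 3) j 𝓜.metric.val y = D_S.h.inner y) ∧ (∀ [𝓜.metric.toPseudoRiemannianMetric.HasLeviCivita] (y : Kerr.slice a M), 𝓜.metric.toPseudoRiemannianMetric.secondFundamentalForm (𝓡 3) j νj y = D_S.kBilin y) ∧ (∀ p ∈ Set.range j, ∀ q ∈ Set.range j, q ∈ 𝓜.metric.causalFuture 𝓜.timeOrientation {p} → q = p) ∧ (∀ y : Kerr.slice a M, j y ∈ 𝓜.metric.causalPast 𝓜.timeOrientation (Set.range 𝓜.embed)) ∧ (∀ [𝓜.metric.HasLeviCivita], ∃ c : ℝ, 0 < c ∧ ∀ C : Set (Kerr.slice a M), IsCompact C → ∃ K : Set X, IsCompact K ∧ ∀ x : X, x ∉ K → ∀ (γ : ℝ → 𝓜.carrier)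 (dom : Set ℝ), 𝓜.metric.IsNormalisedNullRayFrom 𝓜.timeOrientation 𝓜.embed 𝓜.normal x γ dom → ∃ p : Kerr.slice a M, (p : E3) ∈ Kerr.farSlice a M ∧ p ∉ C ∧ ∃ t₀ : ℝ, 0 ≤ t₀ ∧ -t₀ ∈ dom ∧ γ (-t₀) = j p ∧ -c ≤ 𝓜.metric.val (γ (-t₀)) (velocity (𝓡 4) γ (-t₀)) (νj p) ∧ ∀ t ∈ dom, -t₀ ≤ t → t < 0 → γ t ∉ 𝓜.metric.causalFuture 𝓜.timeOrientation (j '' C))) → (∀ (X : Type) [TopologicalSpace X] [ChartedSpace E3 X] [IsManifold (𝓡 3) ∞ X] [T2Space X] [SecondCountableTopology X] [ConnectedSpace X] (D : InitialDataSet (𝓡 3) X) (𝓜 : VacuumCauchyDevelopment D), 𝓜.IsMaximal → ∀ (N : Type) [TopologicalSpace N] [ChartedSpace E3 N] [IsManifold (𝓡 3) ∞ N] [ConnectedSpace N] (D' : InitialDataSet (𝓡 3) N) (j : N → 𝓜.carrier) (ν : NormalField (𝓡 4) j), Manifold.IsSmoothEmbedding (𝓡 3) (𝓡 4) ∞ j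 → 𝓜.metric.IsFutureUnitNormal (𝓡 3) 𝓜.timeOrientation j ν → (∀ y : N, pullbackBilin (I := 𝓡 4) (I' := 𝓡 3) j 𝓜.metric.val y = D'.h.inner y) → (∀ [𝓜.metric.toPseudoRiemannianMetric.HasLeviCivita] (y : N), 𝓜.metric.toPseudoRiemannianMetric.secondFundamentalForm (𝓡 3) j ν y = D'.kBilin y) → (∀ p ∈ Set.range j, ∀ q ∈ Set.range j, q ∈ 𝓜.metric.causalFuture 𝓜.timeOrientation {p} → q = p) → ∃ 𝒟' : VacuumCauchyDevelopment D', 𝒟'.IsMaximal ∧ ∃ χ : 𝒟'.carrier → 𝓜.carrier, ContMDiff (𝓡 4) (𝓡 4) ∞ χ ∧ Topology.IsOpenEmbedding χ ∧ 𝒟'.metric.IsIsometricImmersion 𝓜.metric.toPseudoRiemannianMetric χ ∧ 𝒟'.timeOrientation.PreservesTimeOrientation χ 𝓜.timeOrientation ∧ χ ∘ 𝒟'.embed = j) → ∀ [Kerr.Facts] [Kerr.SliceFacts] (s : ℕ) (δ : ℝ) (M : ℝ) (hM : 0 < M) (ε a : ℝ), (∀ (D : InitialDataSet 𝓘(ℝ,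 E3) (Kerr.slice a M)) [D.metric.HasLeviCivita], D.IsVacuumConstraintSolution → (∀ s' : ℕ, InitialDataSet.dataWeightedSobolevEDist s' δ D (Kerr.data M a M hM.le) < ⊤) → InitialDataSet.dataWeightedSobolevEDist s δ D (Kerr.data M a M hM.le) < ENNReal.ofReal ε → ∀ 𝒟 : VacuumCauchyDevelopment D, 𝒟.IsMaximal → ∃ (M' a' : ℝ) (𝒟oc : Set 𝒟.carrier), Kerr.IsSubextremal M' a' ∧ 𝒟.HasCompleteFutureNullInfinityFar ∧ 𝒟.toSpacetime.ConvergesToKerr 𝒟oc M' a' 2 ∧ |M' - M| + |a' - a| ≤ 1) → ∀ (X : Type) [TopologicalSpace X] [ChartedSpace E3 X] [IsManifold (𝓡 3) ∞ X] [T2Space X] [SecondCountableTopology X] [ConnectedSpace X], ∀ D ∈ admissibleVacuumData X, (∃ (hM' : 0 ≤ M) (φ : Kerr.slice a M → X) (hφ : ContMDiff 𝓘(ℝ, E3) (𝓡 3) (∞ + 1) φ) (hφ' : ∀ u, Function.Injective (mfderiv 𝓘(ℝ, E3) (𝓡 3) φ u)) (ψ : Kerr.slice a M → Kerr.region a M)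 (ν : NormalField 𝓘(ℝ, E4) ψ), |a| < M ∧ IsCompact (Set.range φ)ᶜ ∧ Topology.IsOpenEmbedding φ ∧ (∀ R : ℝ, IsCompact (φ '' {y : Kerr.slice a M | R < Kerr.radius a (E4.ofTimeSpace 0 (y : E3))})ᶜ) ∧ weightedSobolevSeminorm {y : E3 | M < Kerr.radius a (E4.ofTimeSpace 0 y) ∧ Kerr.radius a (E4.ofTimeSpace 0 y) < 4 * M} s δ ((D.comap φ hφ hφ').hFun - (Kerr.data M a M hM').hFun) + weightedSobolevSeminorm {y : E3 | M < Kerr.radius a (E4.ofTimeSpace 0 y) ∧ Kerr.radius a (E4.ofTimeSpace 0 y) < 4 * M} (s - 1) (δ + 1) ((D.comap φ hφ hφ').kFun - (Kerr.data M a M hM').kFun) < ENNReal.ofReal ε ∧ (∀ s' : ℕ, weightedSobolevSeminorm {y : E3 | M < Kerr.radius a (E4.ofTimeSpace 0 y) ∧ Kerr.radius a (E4.ofTimeSpace 0 y) < 4 * M} s' δ ((D.comap φ hφ hφ').hFun - (Kerr.data M a M hM').hFun) + weightedSobolevSeminorm {y : E3 | M < Kerr.radius a (E4.ofTimeSpace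 0 y) ∧ Kerr.radius a (E4.ofTimeSpace 0 y) < 4 * M} (s' - 1) (δ + 1) ((D.comap φ hφ hφ').kFun - (Kerr.data M a M hM').kFun) < ⊤) ∧ (∀ y : Kerr.slice a M, (ψ y : E4) = E4.ofTimeSpace (bentHeight M a (Kerr.radius a (E4.ofTimeSpace 0 (y : E3)))) (y : E3)) ∧ (Kerr.smoothMetric M a M).IsSpacelikeImmersion 𝓘(ℝ, E3) ψ ∧ (Kerr.smoothMetric M a M).IsFutureUnitNormal 𝓘(ℝ, E3) ((Kerr.timeOrientation M a M hM').ofLE le_top) ψ ν ∧ (∀ y : Kerr.slice a M, 3 * M ≤ Kerr.radius a (E4.ofTimeSpace 0 (y : E3)) → pullbackBilin (I := 𝓡 3) (I' := 𝓘(ℝ, E3)) φ D.h.inner y = pullbackBilin (I := 𝓘(ℝ, E4)) (I' := 𝓘(ℝ, E3)) ψ (Kerr.smoothMetric M a M).val y) ∧ (∀ [(Kerr.smoothMetric M a M).HasLeviCivita] (y : Kerr.slice a M), 3 * M ≤ Kerr.radius a (E4.ofTimeSpace 0 (y : E3)) → (pullbackBilin (I := 𝓡 3) (I' := 𝓘(ℝ,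 E3)) φ D.k y).toLinearMap₁₂ = (Kerr.smoothMetric M a M).secondFundamentalForm 𝓘(ℝ, E3) ψ ν y)) → ∀ 𝒟 : VacuumCauchyDevelopment D, 𝒟.IsMaximal → Summit.FinalStateConjecture.HasCompleteNullInfinity 𝒟.toCauchyDevelopment :=
  fun hLP hH _ _ s δ M hM ε a hcap X _ _ _ _ _ _ D _hD hsh 𝒟 h𝒟 ↦ by
    obtain ⟨hM', φ, hφ, hφ', ψ, ν, ha, hcpt, hemb, hends, hclose, hconormal, hψ, hsp, hν, hh, hk⟩ :=
      hsh
    -- the leaf package at this shield and this MGHD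
    obtain ⟨D_S, j, νj, hfarh, hfark, hcolh, hcolk, hjemb, hνj, hjh, hjk, hjac, hjpast, hfoot⟩ :=
      hLP hH M a hM X D φ hφ hφ' ψ ν ha hcpt hemb hends hψ hsp hν hh hk 𝒟 h𝒟
    -- the leaf is a data embedding of `D_S` into `𝒟`
    let 𝒮₂ : DataEmbedding D_S :=
      { toSpacetime := 𝒟.toSpacetime
        embed := j
        isSmoothEmbedding := hjemb
        normal := νj
        isFutureUnitNormal := hνj
        induced_h := hjh
        induced_k := fun y ↦ hjk y }
    -- Stub 2: the MGHD of the leaf datum, realised inside `𝒟`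
    obtain ⟨𝒟S, h𝒟S, χ, hχ, -, hiso, hτ, hχj⟩ :=
      hH X D 𝒟 h𝒟 (Kerr.slice a M) D_S j νj hjemb hνj hjh (fun y ↦ hjk y) hjac
    -- the leaf datum is vacuum, b-conormal and ε-close to `Kerr.data M a M`
    haveI : D_S.metric.HasLeviCivita := D_S.metric.hasLeviCivita
    have hvac : D_S.IsVacuumConstraintSolution := 𝒟S.isVacuumConstraintSolution_data
    obtain ⟨hcon, hdist⟩ := stub_softShieldedScri_leafDatumClose s δ M ε a hM hM.le X D φ hφ hφ'
      D_S hfarh hfark hcolh hcolk hclose hconormal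
    -- the capture block: far-origin sojourn completeness of `𝒟S`
    obtain ⟨-, -, -, -, hfar, -, -⟩ := hcap D_S hvac hcon hdist 𝒟S h𝒟S
    -- `dχ ν_S = ν_j`: uniqueness of the future unit normal of the leaf
    have hνrel : ∀ p : Kerr.slice a M,
        mfderiv (𝓡 4) (𝓡 4) χ (𝒟S.embed p) (𝒟S.normal p) = νj p := fun p ↦
      SubdataDevelopmentsEmbed.mfderiv_normal_rel 𝒟S.toDataEmbedding 𝒮₂ hiso hτ (Φ := id)
        mdifferentiable_id (fun x ↦ by rw [mfderiv_id]; exact injective_id) hχj p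
    -- the leaf `χ ∘ ι_S = j` lies below the data hypersurface
    have hpast : ∀ p : Kerr.slice a M, χ (𝒟S.embed p) ∈
        𝒟.metric.causalPast 𝒟.timeOrientation (Set.range 𝒟.embed) := fun p ↦ by
      rw [show χ (𝒟S.embed p) = j p from congrFun hχj p]
      exact hjpast p
    -- the foot-point hypothesis, read through `χ ∘ ι_S = j`, `dχ ν_S = ν_j`
    have hfoot' : ∀ [𝒟.metric.HasLeviCivita], ∃ c : ℝ, 0 < c ∧ ∀ C : Set (Kerr.slice a M),
        IsCompact C → ∃ K : Set X, IsCompact K ∧ ∀ x : X, x ∉ K →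
        ∀ (γ : ℝ → 𝒟.carrier) (dom : Set ℝ),
        𝒟.metric.IsNormalisedNullRayFrom 𝒟.timeOrientation 𝒟.embed 𝒟.normal x γ dom →
        ∃ p ∈ Set.range (Kerr.farSliceIncl a M), p ∉ C ∧ ∃ t₀ : ℝ, 0 ≤ t₀ ∧ -t₀ ∈ dom ∧
          γ (-t₀) = χ (𝒟S.embed p) ∧
          -c ≤ 𝒟.metric.val (γ (-t₀)) (velocity (𝓡 4) γ (-t₀))
            (mfderiv (𝓡 4) (𝓡 4) χ (𝒟S.embed p) (𝒟S.normal p)) ∧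
          ∀ t ∈ dom, -t₀ ≤ t → t < 0 →
            γ t ∉ 𝒟.metric.causalFuture 𝒟.timeOrientation (χ '' (𝒟S.embed '' C)) := by
      intro inst𝒟
      obtain ⟨c, hc, hC⟩ := hfoot
      refine ⟨c, hc, fun C hCc ↦ ?_⟩
      obtain ⟨K, hK, hKray⟩ := hC C hCc
      refine ⟨K, hK, fun x hx γ dom hγ ↦ ?_⟩
      obtain ⟨p, hpfar, hpC, t₀, ht₀, ht₀dom, hfootpt, hval, havoid⟩ := hKray x hx γ dom hγ
      refine ⟨p, ⟨⟨(p : E3), hpfar⟩, Subtype.ext rfl⟩, hpC, t₀, ht₀, ht₀dom, ?_, ?_,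
        fun t ht h₁ h₂ ↦ ?_⟩
      · rw [hfootpt]; exact (congrFun hχj p).symm
      · rw [hνrel p]; exact hval
      · rw [← image_comp, hχj]; exact havoid t ht h₁ h₂
    -- the registered leaf transfer, with origins the closed far region
    intro inst𝒟
    exact stub_softShieldedScri_leafTransfer X D 𝒟.toCauchyDevelopment (Kerr.slice a M) D_S
      𝒟S.toDataEmbedding χ hχ hiso hτ (Set.range (Kerr.farSliceIncl a M)) hfar hpast hfoot'

/-- **`stub_softShieldedScri` FROM THE UNCONDITIONAL LEAF PACKAGE.**  Same assembly with the leaf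
package stated WITHOUT its Stub-2 hypothesis (the form to register once Stub 2
`stub_hypersurfaceMGHDRealised` is a theorem of the tree: 3040 characters, under the ledger's
4000-character stub limit); it trivially implies the conditional package.
[cite: Christodoulou1999, pp. A26–A27] -/
theorem softShieldedScri_of_leafPackage' : (∀ [Kerr.Facts] [Kerr.SliceFacts] (M a : ℝ) (hM : 0 < M) (X : Type) [TopologicalSpace X] [ChartedSpace E3 X] [IsManifold (𝓡 3) ∞ X] [T2Space X] [SecondCountableTopology X] [ConnectedSpace X] (D : InitialDataSet (𝓡 3) X) (φ : Kerr.slice a M → X) (hφ : ContMDiff 𝓘(ℝ, E3) (𝓡 3) (∞ + 1) φ) (hφ' : ∀ u, Function.Injective (mfderiv 𝓘(ℝ, E3) (𝓡 3) φ u)) (ψ : Kerr.slice a M → Kerr.region a M) (ν : NormalField 𝓘(ℝ, E4) ψ), |a| < M → IsCompact (Set.range φ)ᶜ → Topology.IsOpenEmbedding φ → (∀ R : ℝ, IsCompact (φ '' {y : Kerr.slice a M | R < Kerr.radius a (E4.ofTimeSpace 0 (y : E3))})ᶜ) → (∀ y : Kerr.slice a M, (ψ y : E4) = E4.ofTimeSpace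 (bentHeight M a (Kerr.radius a (E4.ofTimeSpace 0 (y : E3)))) (y : E3)) → (Kerr.smoothMetric M a M).IsSpacelikeImmersion 𝓘(ℝ, E3) ψ → (Kerr.smoothMetric M a M).IsFutureUnitNormal 𝓘(ℝ, E3) ((Kerr.timeOrientation M a M hM.le).ofLE le_top) ψ ν → (∀ y : Kerr.slice a M, 3 * M ≤ Kerr.radius a (E4.ofTimeSpace 0 (y : E3)) → pullbackBilin (I := 𝓡 3) (I' := 𝓘(ℝ, E3)) φ D.h.inner y = pullbackBilin (I := 𝓘(ℝ, E4)) (I' := 𝓘(ℝ, E3)) ψ (Kerr.smoothMetric M a M).val y) → (∀ [(Kerr.smoothMetric M a M).HasLeviCivita] (y : Kerr.slice a M), 3 * M ≤ Kerr.radius a (E4.ofTimeSpace 0 (y : E3)) → (pullbackBilin (I := 𝓡 3) (I' := 𝓘(ℝ, E3)) φ D.k y).toLinearMap₁₂ = (Kerr.smoothMetric M a M).secondFundamentalForm 𝓘(ℝ, E3) ψ ν y) → ∀ (𝓜 : VacuumCauchyDevelopment D), 𝓜.IsMaximal → ∃ (D_S : InitialDataSet 𝓘(ℝ, E3) (Kerr.slice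 a M)) (j : Kerr.slice a M → 𝓜.carrier) (νj : NormalField (𝓡 4) j), (∀ y : E3, 4 * M < Kerr.radius a (E4.ofTimeSpace 0 y) → D_S.hFun y = (Kerr.data M a M hM.le).hFun y) ∧ (∀ y : E3, 4 * M < Kerr.radius a (E4.ofTimeSpace 0 y) → D_S.kFun y = (Kerr.data M a M hM.le).kFun y) ∧ (∀ y : E3, M < Kerr.radius a (E4.ofTimeSpace 0 y) → Kerr.radius a (E4.ofTimeSpace 0 y) < 4 * M → (D.comap φ hφ hφ').hFun y = D_S.hFun y) ∧ (∀ y : E3, M < Kerr.radius a (E4.ofTimeSpace 0 y) → Kerr.radius a (E4.ofTimeSpace 0 y) < 4 * M → (D.comap φ hφ hφ').kFun y = D_S.kFun y) ∧ Manifold.IsSmoothEmbedding (𝓡 3) (𝓡 4) ∞ j ∧ 𝓜.metric.IsFutureUnitNormal (𝓡 3) 𝓜.timeOrientation j νj ∧ (∀ y : Kerr.slice a M, pullbackBilin (I := 𝓡 4) (I' := 𝓡 3) j 𝓜.metric.val y = D_S.h.inner y) ∧ (∀ [𝓜.metric.toPseudoRiemannianMetric.HasLeviCivita] (y : Kerr.slice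 a M), 𝓜.metric.toPseudoRiemannianMetric.secondFundamentalForm (𝓡 3) j νj y = D_S.kBilin y) ∧ (∀ p ∈ Set.range j, ∀ q ∈ Set.range j, q ∈ 𝓜.metric.causalFuture 𝓜.timeOrientation {p} → q = p) ∧ (∀ y : Kerr.slice a M, j y ∈ 𝓜.metric.causalPast 𝓜.timeOrientation (Set.range 𝓜.embed)) ∧ (∀ [𝓜.metric.HasLeviCivita], ∃ c : ℝ, 0 < c ∧ ∀ C : Set (Kerr.slice a M), IsCompact C → ∃ K : Set X, IsCompact K ∧ ∀ x : X, x ∉ K → ∀ (γ : ℝ → 𝓜.carrier) (dom : Set ℝ), 𝓜.metric.IsNormalisedNullRayFrom 𝓜.timeOrientation 𝓜.embed 𝓜.normal x γ dom → ∃ p : Kerr.slice a M, (p : E3) ∈ Kerr.farSlice a M ∧ p ∉ C ∧ ∃ t₀ : ℝ, 0 ≤ t₀ ∧ -t₀ ∈ dom ∧ γ (-t₀) = j p ∧ -c ≤ 𝓜.metric.val (γ (-t₀)) (velocity (𝓡 4) γ (-t₀)) (νj p) ∧ ∀ t ∈ dom, -t₀ ≤ t → t < 0 → γ t ∉ 𝓜.metric.causalFuture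 𝓜.timeOrientation (j '' C))) → (∀ (X : Type) [TopologicalSpace X] [ChartedSpace E3 X] [IsManifold (𝓡 3) ∞ X] [T2Space X] [SecondCountableTopology X] [ConnectedSpace X] (D : InitialDataSet (𝓡 3) X) (𝓜 : VacuumCauchyDevelopment D), 𝓜.IsMaximal → ∀ (N : Type) [TopologicalSpace N] [ChartedSpace E3 N] [IsManifold (𝓡 3) ∞ N] [ConnectedSpace N] (D' : InitialDataSet (𝓡 3) N) (j : N → 𝓜.carrier) (ν : NormalField (𝓡 4) j), Manifold.IsSmoothEmbedding (𝓡 3) (𝓡 4) ∞ j → 𝓜.metric.IsFutureUnitNormal (𝓡 3) 𝓜.timeOrientation j ν → (∀ y : N, pullbackBilin (I := 𝓡 4) (I' := 𝓡 3) j 𝓜.metric.val y = D'.h.inner y) → (∀ [𝓜.metric.toPseudoRiemannianMetric.HasLeviCivita] (y : N), 𝓜.metric.toPseudoRiemannianMetric.secondFundamentalForm (𝓡 3) j ν y = D'.kBilin y) → (∀ p ∈ Set.range j, ∀ q ∈ Set.range j, q ∈ 𝓜.metric.causalFuture 𝓜.timeOrientation {p} → q = p) → ∃ 𝒟' : VacuumCauchyDevelopment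 D', 𝒟'.IsMaximal ∧ ∃ χ : 𝒟'.carrier → 𝓜.carrier, ContMDiff (𝓡 4) (𝓡 4) ∞ χ ∧ Topology.IsOpenEmbedding χ ∧ 𝒟'.metric.IsIsometricImmersion 𝓜.metric.toPseudoRiemannianMetric χ ∧ 𝒟'.timeOrientation.PreservesTimeOrientation χ 𝓜.timeOrientation ∧ χ ∘ 𝒟'.embed = j) → ∀ [Kerr.Facts] [Kerr.SliceFacts] (s : ℕ) (δ : ℝ) (M : ℝ) (hM : 0 < M) (ε a : ℝ), (∀ (D : InitialDataSet 𝓘(ℝ, E3) (Kerr.slice a M)) [D.metric.HasLeviCivita], D.IsVacuumConstraintSolution → (∀ s' : ℕ, InitialDataSet.dataWeightedSobolevEDist s' δ D (Kerr.data M a M hM.le) < ⊤) → InitialDataSet.dataWeightedSobolevEDist s δ D (Kerr.data M a M hM.le) < ENNReal.ofReal ε → ∀ 𝒟 : VacuumCauchyDevelopment D, 𝒟.IsMaximal → ∃ (M' a' : ℝ) (𝒟oc : Set 𝒟.carrier), Kerr.IsSubextremal M' a' ∧ 𝒟.HasCompleteFutureNullInfinityFar ∧ 𝒟.toSpacetime.ConvergesToKerr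 𝒟oc M' a' 2 ∧ |M' - M| + |a' - a| ≤ 1) → ∀ (X : Type) [TopologicalSpace X] [ChartedSpace E3 X] [IsManifold (𝓡 3) ∞ X] [T2Space X] [SecondCountableTopology X] [ConnectedSpace X], ∀ D ∈ admissibleVacuumData X, (∃ (hM' : 0 ≤ M) (φ : Kerr.slice a M → X) (hφ : ContMDiff 𝓘(ℝ, E3) (𝓡 3) (∞ + 1) φ) (hφ' : ∀ u, Function.Injective (mfderiv 𝓘(ℝ, E3) (𝓡 3) φ u)) (ψ : Kerr.slice a M → Kerr.region a M) (ν : NormalField 𝓘(ℝ, E4) ψ), |a| < M ∧ IsCompact (Set.range φ)ᶜ ∧ Topology.IsOpenEmbedding φ ∧ (∀ R : ℝ, IsCompact (φ '' {y : Kerr.slice a M | R < Kerr.radius a (E4.ofTimeSpace 0 (y : E3))})ᶜ) ∧ weightedSobolevSeminorm {y : E3 | M < Kerr.radius a (E4.ofTimeSpace 0 y) ∧ Kerr.radius a (E4.ofTimeSpace 0 y) < 4 * M} s δ ((D.comap φ hφ hφ').hFun - (Kerr.data M a M hM').hFun) + weightedSobolevSeminorm {y : E3 | M < Kerr.radius a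 (E4.ofTimeSpace 0 y) ∧ Kerr.radius a (E4.ofTimeSpace 0 y) < 4 * M} (s - 1) (δ + 1) ((D.comap φ hφ hφ').kFun - (Kerr.data M a M hM').kFun) < ENNReal.ofReal ε ∧ (∀ s' : ℕ, weightedSobolevSeminorm {y : E3 | M < Kerr.radius a (E4.ofTimeSpace 0 y) ∧ Kerr.radius a (E4.ofTimeSpace 0 y) < 4 * M} s' δ ((D.comap φ hφ hφ').hFun - (Kerr.data M a M hM').hFun) + weightedSobolevSeminorm {y : E3 | M < Kerr.radius a (E4.ofTimeSpace 0 y) ∧ Kerr.radius a (E4.ofTimeSpace 0 y) < 4 * M} (s' - 1) (δ + 1) ((D.comap φ hφ hφ').kFun - (Kerr.data M a M hM').kFun) < ⊤) ∧ (∀ y : Kerr.slice a M, (ψ y : E4) = E4.ofTimeSpace (bentHeight M a (Kerr.radius a (E4.ofTimeSpace 0 (y : E3)))) (y : E3)) ∧ (Kerr.smoothMetric M a M).IsSpacelikeImmersion 𝓘(ℝ, E3) ψ ∧ (Kerr.smoothMetric M a M).IsFutureUnitNormal 𝓘(ℝ, E3) ((Kerr.timeOrientation M a M hM').ofLE le_top)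 ψ ν ∧ (∀ y : Kerr.slice a M, 3 * M ≤ Kerr.radius a (E4.ofTimeSpace 0 (y : E3)) → pullbackBilin (I := 𝓡 3) (I' := 𝓘(ℝ, E3)) φ D.h.inner y = pullbackBilin (I := 𝓘(ℝ, E4)) (I' := 𝓘(ℝ, E3)) ψ (Kerr.smoothMetric M a M).val y) ∧ (∀ [(Kerr.smoothMetric M a M).HasLeviCivita] (y : Kerr.slice a M), 3 * M ≤ Kerr.radius a (E4.ofTimeSpace 0 (y : E3)) → (pullbackBilin (I := 𝓡 3) (I' := 𝓘(ℝ, E3)) φ D.k y).toLinearMap₁₂ = (Kerr.smoothMetric M a M).secondFundamentalForm 𝓘(ℝ, E3) ψ ν y)) → ∀ 𝒟 : VacuumCauchyDevelopment D, 𝒟.IsMaximal → Summit.FinalStateConjecture.HasCompleteNullInfinity 𝒟.toCauchyDevelopment :=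
  fun hLP ↦ softShieldedScri_of_leafPackage fun _ ↦ hLP

end SoftShieldedScri

end Summit.FinalStateConjecture.FinalStateConjecture.Theorems.CaptureSufficesC2.Sketch

end
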